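import Mathlib.NumberTheory.LSeries.Linearity
import Mathlib.NumberTheory.LSeries.Convergence
import Mathlib.Analysis.Normed.Group.Tannery
import HarnessLib

/-!
# Dirichlet series with Hecke recursions do not vanish in the half-plane of absolute convergence

Let `a : ℕ → ℂ` satisfy `a 1 = 1` and, at every prime `p`, a **Hecke recursion**
`a(pn) = λ_p a(n) - μ_p 𝟙_{p ∣ n} a(n/p)` (`n ≥ 1`), as do the Fourier coefficients of a normalised
simultaneous eigenform of the Hecke operators `T_p` (all `p`) and the diamond operators on
`S_k(Γ₁(N))` (`λ_p` the `T_p`-eigenvalue, `μ_p = ε(p) p^{k-1}` resp. `0` for `p ∣ N`;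
Diamond–Shurman, Prop. 5.8.5), or their twists `χ(n) a(n)` by a Dirichlet character.  Then
`L(a, s) = ∑ a(n) n^{-s} ≠ 0` at every `s` where the series converges absolutely
(`LSeries_ne_zero_of_heckeRecursion`).

The proof avoids Euler products (and any Ramanujan-type bound on the local roots): removing the
multiples of a prime `p` multiplies the series by the polynomial `1 - λ_p p^{-s} + μ_p p^{-2s}`
(`LSeries_sieve_prime`), so if `L(a, s) = 0` then the series `∑_{n : p ∣ n ⇒ p > P} a(n) n^{-s}`
vanishes for every `P`; but it tends to `a(1) = 1` as `P → ∞` (its terms with `1 < n ≤ P` are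
zero and the rest is a tail of an absolutely convergent series).  This is the classical argument
that an absolutely convergent Euler product of non-degenerate shape is non-zero
(cf. Diamond–Shurman Thm. 5.9.2; Shimura 1971, Thm. 3.43), arranged so that only finite
products occur.

Everything is proved; there are no named facts.

## References

* F. Diamond, J. Shurman, *A first course in modular forms*, GTM 228 (2005), Prop. 5.8.5,
  Thm. 5.9.2.
* G. Shimura, *Introduction to the arithmetic theory of automorphic functions*, Publ. Math. Soc.
  Japan 11 (1971), Thm. 3.43.
-/

noncomputable section

open Filter Topology Complex LSeries

namespace Literature.NumberTheory.EllipticCurves.ModularForms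

namespace HeckeRecursionLSeries

/-! ### Re-indexing a Dirichlet series along the multiples of `d` -/

/-- The sequence `m ↦ 𝟙_{d ∣ m} e(m/d)` ("`e` pushed forward along `n ↦ dn`"). [folklore] -/
def pushMul (d : ℕ) (e : ℕ → ℂ) : ℕ → ℂ := fun m ↦ if d ∣ m then e (m / d) else 0

/-- `pushMul d e (d n) = e n` for `d ≠ 0`. [folklore] -/
theorem pushMul_mul {d : ℕ} (hd : d ≠ 0) (e : ℕ → ℂ) (n : ℕ) : pushMul d e (d * n) = e n := by
  simp [pushMul, Nat.mul_div_cancel_left n (Nat.pos_of_ne_zero hd)]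

/-- The terms of `∑ 𝟙_{d∣m} e(m/d) m^{-s}` along `m = dn` are `d^{-s}` times the terms of
`∑ e(n) n^{-s}`. [folklore] -/
theorem term_pushMul_mul {d : ℕ} (hd : d ≠ 0) (e : ℕ → ℂ) (s : ℂ) (n : ℕ) :
    term (pushMul d e) s (d * n) = (d : ℂ) ^ (-s) * term e s n := by
  rcases eq_or_ne n 0 with rfl | hn
  · simp [term_zero]
  · rw [term_of_ne_zero (mul_ne_zero hd hn), term_of_ne_zero hn, pushMul_mul hd, Nat.cast_mul,
      natCast_mul_natCast_cpow, cpow_neg]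
    field_simp

/-- The terms of `∑ 𝟙_{d∣m} e(m/d) m^{-s}` vanish off the multiples of `d`. [folklore] -/
theorem term_pushMul_of_not_dvd {d : ℕ} (e : ℕ → ℂ) (s : ℂ) {m : ℕ} (hm : ¬ d ∣ m) :
    term (pushMul d e) s m = 0 := by
  rcases eq_or_ne m 0 with rfl | hm0
  · simp [term_zero]
  · rw [term_of_ne_zero hm0, pushMul, if_neg hm, zero_div]

/-- The terms of `∑ 𝟙_{d∣m} e(m/d) m^{-s}` are supported on the multiples of `d`. [folklore] -/
theorem support_term_pushMul (d : ℕ) (e : ℕ → ℂ) (s : ℂ) :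
    Function.support (fun m ↦ term (pushMul d e) s m) ⊆ Set.range fun n : ℕ ↦ d * n := by
  intro m hm
  by_contra hrange
  apply hm
  apply term_pushMul_of_not_dvd
  rintro ⟨n, rfl⟩
  exact hrange ⟨n, rfl⟩

/-- **Re-indexing**: `∑ₘ 𝟙_{d∣m} e(m/d) m^{-s} = d^{-s} ∑ₙ e(n) n^{-s}` (as sums, convergent or not,
the left-hand terms being supported on `dℕ`). [folklore] -/
theorem LSeries_pushMul {d : ℕ} (hd : d ≠ 0) (e : ℕ → ℂ) (s : ℂ) :
    LSeries (pushMul d e) s = (d : ℂ) ^ (-s) * LSeries e s := by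
  rw [LSeries, LSeries, ← tsum_mul_left]
  have hinj : Function.Injective fun n : ℕ ↦ d * n := fun a b h ↦ Nat.eq_of_mul_eq_mul_left
    (Nat.pos_of_ne_zero hd) h
  rw [← hinj.tsum_eq (support_term_pushMul d e s)]
  exact tsum_congr fun n ↦ term_pushMul_mul hd e s n

/-- Summability transfers along the re-indexing. [folklore] -/
theorem lseriesSummable_pushMul {d : ℕ} (hd : d ≠ 0) {e : ℕ → ℂ} {s : ℂ}
    (he : LSeriesSummable e s) : LSeriesSummable (pushMul d e) s := by
  rw [LSeriesSummable]
  have hinj : Function.Injective fun n : ℕ ↦ d * n := fun a b h ↦ Nat.eq_of_mul_eq_mul_left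
    (Nat.pos_of_ne_zero hd) h
  refine (Function.Injective.summable_iff hinj (fun m hm ↦ ?_)).mp ?_
  · by_contra h
    exact hm (support_term_pushMul d e s h)
  simp only [Function.comp_def, term_pushMul_mul hd]
  exact he.mul_left _

/-- Domination transfers summability of `L`-series: if `‖f n‖ ≤ ‖g n‖` for all `n ≥ 1` then
`LSeriesSummable g s → LSeriesSummable f s`. [folklore] -/
theorem lseriesSummable_of_norm_le {f g : ℕ → ℂ} (hle : ∀ n : ℕ, n ≠ 0 → ‖f n‖ ≤ ‖g n‖) {s : ℂ}
    (hg : LSeriesSummable g s) : LSeriesSummable f s := by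
  refine Summable.of_norm_bounded hg.norm fun n ↦ ?_
  rcases eq_or_ne n 0 with rfl | hn
  · simp [term_zero]
  · rw [term_of_ne_zero hn, term_of_ne_zero hn, norm_div, norm_div]
    exact div_le_div_of_nonneg_right (hle n hn) (norm_nonneg _)

/-! ### Sieving out one prime -/

/-- The sequence with the multiples of `p` removed. [folklore] -/
def sievePrime (p : ℕ) (b : ℕ → ℂ) : ℕ → ℂ := fun n ↦ if p ∣ n then 0 else b n

/-- **Removing the multiples of a prime multiplies the series by the Hecke polynomial**: if
`b(pn) = λ b(n) - μ 𝟙_{p∣n} b(n/p)` for all `n ≥ 1` and `∑ b(n) n^{-s}` converges absolutely, then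
`∑_{p ∤ n} b(n) n^{-s} = (1 - λ p^{-s} + μ p^{-2s}) ∑ b(n) n^{-s}`. [folklore] -/
theorem LSeries_sievePrime {p : ℕ} (hp : p.Prime) {b : ℕ → ℂ} {lam mu : ℂ}
    (hrec : ∀ n : ℕ, 0 < n → b (p * n) = lam * b n - mu * (if p ∣ n then b (n / p) else 0))
    {s : ℂ} (hb : LSeriesSummable b s) :
    LSeries (sievePrime p b) s =
      (1 - lam * (p : ℂ) ^ (-s) + mu * (p : ℂ) ^ (-(2 * s))) * LSeries b s := by
  have hp0 : p ≠ 0 := hp.ne_zero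
  have hp2 : p * p ≠ 0 := mul_ne_zero hp0 hp0
  -- the two shifted series
  set c₁ : ℕ → ℂ := pushMul p (fun n ↦ lam * b n) with hc₁
  set c₂ : ℕ → ℂ := pushMul (p * p) (fun n ↦ mu * b n) with hc₂
  have hs₁ : LSeriesSummable c₁ s := lseriesSummable_pushMul hp0 (hb.smul lam)
  have hs₂ : LSeriesSummable c₂ s := lseriesSummable_pushMul hp2 (hb.smul mu)
  have hL₁ : LSeries c₁ s = lam * (p : ℂ) ^ (-s) * LSeries b s := by
    rw [hc₁, LSeries_pushMul hp0, show (fun n ↦ lam * b n) = lam • b from rfl, LSeries_smul]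
    ring
  have hL₂ : LSeries c₂ s = mu * (p : ℂ) ^ (-(2 * s)) * LSeries b s := by
    rw [hc₂, LSeries_pushMul hp2, show (fun n ↦ mu * b n) = mu • b from rfl, LSeries_smul,
      Nat.cast_mul, natCast_mul_natCast_cpow, ← cpow_add _ _ (by exact_mod_cast hp0)]
    ring_nf
  -- pointwise identity `sievePrime p b = b - c₁ + c₂` away from `0`
  have hpt : ∀ {m : ℕ}, m ≠ 0 → sievePrime p b m = (b - c₁ + c₂) m := by
    intro m hm0
    simp only [Pi.add_apply, Pi.sub_apply, sievePrime, hc₁, hc₂, pushMul]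
    by_cases hpm : p ∣ m
    · rw [if_pos hpm, if_pos hpm]
      obtain ⟨m', rfl⟩ := hpm
      have hm' : 0 < m' := Nat.pos_of_ne_zero fun h ↦ hm0 (by rw [h, mul_zero])
      rw [Nat.mul_div_cancel_left m' hp.pos, hrec m' hm']
      by_cases hpm' : p ∣ m'
      · rw [if_pos hpm', if_pos (Nat.mul_dvd_mul_left p hpm')]
        obtain ⟨m'', rfl⟩ := hpm'
        rw [Nat.mul_div_cancel_left m'' hp.pos, show p * (p * m'') / (p * p) = m'' by
          rw [← mul_assoc, Nat.mul_div_cancel_left m'' (Nat.pos_of_ne_zero hp2)]]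
        ring
      · rw [if_neg hpm', if_neg (fun h ↦ hpm' ?_)]
        · ring
        · obtain ⟨k, hk⟩ := h
          exact ⟨k, Nat.eq_of_mul_eq_mul_left hp.pos (by rw [hk]; ring)⟩
    · rw [if_neg hpm, if_neg hpm, if_neg (fun h ↦ hpm (dvd_trans (dvd_mul_right p p) h))]
      ring
  rw [LSeries_congr hpt s, LSeries_add (hb.sub hs₁) hs₂, LSeries_sub hb hs₁, hL₁, hL₂]
  ring

/-- Summability of the sieved series. [folklore] -/
theorem lseriesSummable_sievePrime (p : ℕ) {b : ℕ → ℂ} {s : ℂ} (hb : LSeriesSummable b s) :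
    LSeriesSummable (sievePrime p b) s := by
  refine lseriesSummable_of_norm_le (fun n _ ↦ ?_) hb
  rw [sievePrime]
  split_ifs
  · rw [norm_zero]; positivity
  · exact le_rfl

/-! ### Sieving out all primes `≤ P` -/

/-- "`n` has no prime factor `≤ P`". [folklore] -/
def NoPrimeFactorLE (P n : ℕ) : Prop := ∀ q : ℕ, q.Prime → q ≤ P → ¬ q ∣ n

/-- The condition at `P + 1` in terms of the condition at `P`. [folklore] -/
theorem noPrimeFactorLE_succ_iff (P n : ℕ) :
    NoPrimeFactorLE (P + 1) n ↔ NoPrimeFactorLE P n ∧ ((P + 1).Prime → ¬ (P + 1) ∣ n) := by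
  refine ⟨fun h ↦ ⟨fun q hq hqP ↦ h q hq (hqP.trans (Nat.le_succ P)), fun hP ↦ h _ hP le_rfl⟩,
    fun h q hq hqP ↦ ?_⟩
  rcases Nat.lt_or_eq_of_le hqP with hlt | rfl
  · exact h.1 q hq (Nat.lt_succ_iff.mp hlt)
  · exact h.2 hq

open scoped Classical in
/-- The sequence with all multiples of primes `≤ P` removed. [folklore] -/
def sieveUpTo (P : ℕ) (a : ℕ → ℂ) : ℕ → ℂ := fun n ↦ if NoPrimeFactorLE P n then a n else 0

/-- Value where the sieving condition holds. [folklore] -/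
theorem sieveUpTo_of_pos {P : ℕ} (a : ℕ → ℂ) {n : ℕ} (h : NoPrimeFactorLE P n) :
    sieveUpTo P a n = a n := by
  classical
  rw [sieveUpTo, if_pos h]

/-- Value where the sieving condition fails. [folklore] -/
theorem sieveUpTo_of_neg {P : ℕ} (a : ℕ → ℂ) {n : ℕ} (h : ¬ NoPrimeFactorLE P n) :
    sieveUpTo P a n = 0 := by
  classical
  rw [sieveUpTo, if_neg h]

/-- `sieveUpTo 0 a = a`. [folklore] -/
theorem sieveUpTo_zero (a : ℕ → ℂ) : sieveUpTo 0 a = a := by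
  funext n
  refine sieveUpTo_of_pos a fun q hq hq0 ↦ ?_
  exact absurd (le_antisymm hq0 (Nat.zero_le q) ▸ hq) Nat.not_prime_zero

/-- One more step: if `P + 1` is prime, sieve it out; otherwise nothing changes. [folklore] -/
theorem sieveUpTo_succ (P : ℕ) (a : ℕ → ℂ) :
    sieveUpTo (P + 1) a =
      if (P + 1).Prime then sievePrime (P + 1) (sieveUpTo P a) else sieveUpTo P a := by
  funext n
  by_cases hP : (P + 1).Prime
  · rw [if_pos hP, sievePrime]
    by_cases hdiv : (P + 1) ∣ n
    · rw [if_pos hdiv]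
      exact sieveUpTo_of_neg a fun h ↦ ((noPrimeFactorLE_succ_iff P n).mp h).2 hP hdiv
    · rw [if_neg hdiv]
      by_cases hc : NoPrimeFactorLE P n
      · rw [sieveUpTo_of_pos a hc, sieveUpTo_of_pos a ((noPrimeFactorLE_succ_iff P n).mpr ⟨hc, fun _ ↦ hdiv⟩)]
      · rw [sieveUpTo_of_neg a hc, sieveUpTo_of_neg a fun h ↦ hc ((noPrimeFactorLE_succ_iff P n).mp h).1]
  · rw [if_neg hP]
    by_cases hc : NoPrimeFactorLE P n
    · rw [sieveUpTo_of_pos a hc, sieveUpTo_of_pos a ((noPrimeFactorLE_succ_iff P n).mpr ⟨hc, fun h ↦ absurd h hP⟩)]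
    · rw [sieveUpTo_of_neg a hc, sieveUpTo_of_neg a fun h ↦ hc ((noPrimeFactorLE_succ_iff P n).mp h).1]

/-- For a prime `p > P`, the sieving condition is the same at `pn` and at `n`. [folklore] -/
theorem noPrimeFactorLE_mul_iff {p : ℕ} (hp : p.Prime) {P : ℕ} (hpP : P < p) (n : ℕ) :
    NoPrimeFactorLE P (p * n) ↔ NoPrimeFactorLE P n := by
  refine ⟨fun h q hq hqP hqn ↦ h q hq hqP (dvd_mul_of_dvd_right hqn p), fun h q hq hqP hqpn ↦ ?_⟩
  rcases (Nat.Prime.dvd_mul hq).mp hqpn with hqp | hqn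
  · have : q = p := (Nat.prime_dvd_prime_iff_eq hq hp).mp hqp
    omega
  · exact h q hq hqP hqn

/-- The sieved sequences inherit the Hecke recursion at every prime `p > P`. [folklore] -/
theorem sieveUpTo_rec {a : ℕ → ℂ} {p : ℕ} (hp : p.Prime) {P : ℕ} (hpP : P < p) {lam mu : ℂ}
    (hrec : ∀ n : ℕ, 0 < n → a (p * n) = lam * a n - mu * (if p ∣ n then a (n / p) else 0))
    (n : ℕ) (hn : 0 < n) :
    sieveUpTo P a (p * n) = lam * sieveUpTo P a n -
      mu * (if p ∣ n then sieveUpTo P a (n / p) else 0) := by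
  by_cases hcond : NoPrimeFactorLE P n
  · rw [sieveUpTo_of_pos a ((noPrimeFactorLE_mul_iff hp hpP n).mpr hcond), sieveUpTo_of_pos a hcond,
      hrec n hn]
    by_cases hpn : p ∣ n
    · rw [if_pos hpn, if_pos hpn, sieveUpTo_of_pos a]
      obtain ⟨n', rfl⟩ := hpn
      rw [Nat.mul_div_cancel_left n' hp.pos]
      exact (noPrimeFactorLE_mul_iff hp hpP n').mp hcond
    · rw [if_neg hpn, if_neg hpn]
  · rw [sieveUpTo_of_neg a (fun h ↦ hcond ((noPrimeFactorLE_mul_iff hp hpP n).mp h)),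
      sieveUpTo_of_neg a hcond]
    by_cases hpn : p ∣ n
    · rw [if_pos hpn, sieveUpTo_of_neg a]
      · ring
      · obtain ⟨n', rfl⟩ := hpn
        rw [Nat.mul_div_cancel_left n' hp.pos]
        exact fun h ↦ hcond ((noPrimeFactorLE_mul_iff hp hpP n').mpr h)
    · rw [if_neg hpn]
      ring

/-- Summability of the sieved series. [folklore] -/
theorem lseriesSummable_sieveUpTo (P : ℕ) {a : ℕ → ℂ} {s : ℂ} (ha : LSeriesSummable a s) :
    LSeriesSummable (sieveUpTo P a) s := by
  refine lseriesSummable_of_norm_le (fun n _ ↦ ?_) ha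
  by_cases hc : NoPrimeFactorLE P n
  · rw [sieveUpTo_of_pos a hc]
  · rw [sieveUpTo_of_neg a hc, norm_zero]; positivity

/-- **If `L(a, s) = 0` then every sieved series vanishes at `s`** (by `LSeries_sievePrime`,
inductively in `P`). [folklore] -/
theorem LSeries_sieveUpTo_eq_zero {a : ℕ → ℂ}
    (hrec : ∀ p : ℕ, p.Prime → ∃ lam mu : ℂ, ∀ n : ℕ, 0 < n →
      a (p * n) = lam * a n - mu * (if p ∣ n then a (n / p) else 0))
    {s : ℂ} (ha : LSeriesSummable a s) (h0 : LSeries a s = 0) (P : ℕ) :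
    LSeries (sieveUpTo P a) s = 0 := by
  induction P with
  | zero => rwa [sieveUpTo_zero]
  | succ P ih =>
    rw [sieveUpTo_succ]
    split_ifs with hP
    · obtain ⟨lam, mu, hlm⟩ := hrec (P + 1) hP
      rw [LSeries_sievePrime hP (sieveUpTo_rec hP (Nat.lt_succ_self P) hlm)
        (lseriesSummable_sieveUpTo P ha), ih, mul_zero]
    · exact ih

/-- The sieved sequence vanishes on `1 < n ≤ P`. [folklore] -/
theorem sieveUpTo_eq_zero_of_le (a : ℕ → ℂ) {P n : ℕ} (h1 : 1 < n) (hn : n ≤ P) :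
    sieveUpTo P a n = 0 := by
  refine sieveUpTo_of_neg a fun h ↦ ?_
  obtain ⟨q, hq, hqn⟩ := Nat.exists_prime_and_dvd h1.ne'
  exact h q hq ((Nat.le_of_dvd (by omega) hqn).trans hn) hqn

/-- `sieveUpTo P a 1 = a 1`. [folklore] -/
theorem sieveUpTo_one (P : ℕ) (a : ℕ → ℂ) : sieveUpTo P a 1 = a 1 := by
  refine sieveUpTo_of_pos a fun q hq _ hq1 ↦ ?_
  exact hq.one_lt.ne' (Nat.dvd_one.mp hq1)

/-- **The sieved series tend to `a 1`** as `P → ∞`: their terms with `1 < n ≤ P` vanish and the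
rest is dominated by the terms of `∑ |a(n) n^{-s}|` (Tannery's theorem). [folklore] -/
theorem tendsto_LSeries_sieveUpTo {a : ℕ → ℂ} {s : ℂ} (ha : LSeriesSummable a s) :
    Tendsto (fun P : ℕ ↦ LSeries (sieveUpTo P a) s) atTop (𝓝 (a 1)) := by
  have hlim : ∀ n : ℕ, Tendsto (fun P : ℕ ↦ term (sieveUpTo P a) s n) atTop
      (𝓝 (if n = 1 then a 1 else 0)) := by
    intro n
    rcases eq_or_ne n 0 with rfl | hn0
    · simp [term_zero]
    rcases eq_or_ne n 1 with rfl | hn1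
    · simp only [if_true]
      refine tendsto_const_nhds.congr fun P ↦ ?_
      rw [term_of_ne_zero one_ne_zero, sieveUpTo_one, Nat.cast_one, one_cpow, div_one]
    · rw [if_neg hn1]
      refine tendsto_const_nhds.congr' ?_
      filter_upwards [eventually_ge_atTop n] with P hP
      rw [term_of_ne_zero hn0, sieveUpTo_eq_zero_of_le a (by omega) hP, zero_div]
  have hbound : ∀ᶠ P : ℕ in atTop, ∀ n : ℕ, ‖term (sieveUpTo P a) s n‖ ≤ ‖term a s n‖ := by
    refine Eventually.of_forall fun P n ↦ ?_
    rcases eq_or_ne n 0 with rfl | hn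
    · simp [term_zero]
    · rw [term_of_ne_zero hn, term_of_ne_zero hn, norm_div, norm_div]
      refine div_le_div_of_nonneg_right ?_ (norm_nonneg _)
      by_cases hc : NoPrimeFactorLE P n
      · rw [sieveUpTo_of_pos a hc]
      · rw [sieveUpTo_of_neg a hc, norm_zero]; positivity
  have key := tendsto_tsum_of_dominated_convergence ha.norm hlim hbound
  have hsum : ∑' n : ℕ, (if n = 1 then a 1 else 0) = a 1 := tsum_ite_eq 1 (fun _ : ℕ ↦ a 1)
  rwa [hsum] at key

/-- **Dirichlet series with Hecke recursions do not vanish where they converge absolutely.**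
If `a 1 = 1`, `a(pn) = λ_p a(n) - μ_p 𝟙_{p∣n} a(n/p)` at every prime `p` (`n ≥ 1`), and
`∑ a(n) n^{-s}` converges absolutely at `s`, then `L(a, s) ≠ 0`: otherwise all sieved series vanish
at `s` (`LSeries_sieveUpTo_eq_zero`) although they tend to `a 1 = 1` (`tendsto_LSeries_sieveUpTo`).
(For an eigenform this is the non-vanishing of its `L`-function in the region of absolute
convergence, classically via the Euler product, Diamond–Shurman Thm. 5.9.2.) [folklore] -/
theorem LSeries_ne_zero_of_heckeRecursion {a : ℕ → ℂ} (h1 : a 1 = 1)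
    (hrec : ∀ p : ℕ, p.Prime → ∃ lam mu : ℂ, ∀ n : ℕ, 0 < n →
      a (p * n) = lam * a n - mu * (if p ∣ n then a (n / p) else 0))
    {s : ℂ} (ha : LSeriesSummable a s) : LSeries a s ≠ 0 := by
  intro h0
  have h := tendsto_LSeries_sieveUpTo ha
  rw [h1] at h
  have h' : Tendsto (fun P : ℕ ↦ LSeries (sieveUpTo P a) s) atTop (𝓝 0) :=
    tendsto_const_nhds.congr fun P ↦ (LSeries_sieveUpTo_eq_zero hrec ha h0 P).symm
  exact one_ne_zero (tendsto_nhds_unique h h')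

end HeckeRecursionLSeries

end Literature.NumberTheory.EllipticCurves.ModularForms
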